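import Mathlib
import HarnessLib
import Summits.HubbardSuperconductivity.HubbardSuperconductivity.Theorems.KLProgrammeKLRegimeCountertermLevelStep

/-!
# Route `KLProgramme` — the Counterterm child of crux K3 (gen-3 item stmt-HubbardSuperconductivity-19825 `KLRegimeCountertermV11`):
# THE LEVEL RECURSION `K^{(−1)} = 0`, `K^{(n)} = P^G K^{(n−1)} ⊖ D_n^G K^{(n−1)}` — existence of the level frames with their three
# invariants (admissible; renormalised at every scale `≤ n`; partial sums bounded) at one volume
# (seat hubbard-kl-k3c3-p1, part J₁; iterates part I `levelStep` from the zero frame)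

Under the hypotheses of part I (`…CountertermLevelStep`: the V11 block at one volume beyond the thresholds, the five conditions of
`frameOK_of_multiSlot`, the contraction bound `qq` with `32·qq ≤ 1`, the gate with wiggle constant `w`) and the tolerance arithmetic
`2·qq·b n + Σ_{j<i≤n} b i + w ≤ tol j` for all `j ≤ n ≤ nScales β` (`b i = twoLegBar G Q U 0 i`):

* `frameOK_zeroFrame` — the zero frame is admissible (the start of the recursion; `frameOK_of_pieces` with zero pieces);
* **`exists_levelFrame`** — for every `n ≤ nScales β` there is a frame `F` with `FrameOK (ctRenMs G) U (nScales β) μ F`,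
  `RenormalisedAtF L M β U μ F (ctRenMs G) j` for all `j ≤ n`, `|F(q) + Σ_{i≤j} ℓ_i^G(F)(q)| ≤ 2·qq·b n + Σ_{j<i≤n} b i` for all `j ≤ n`
  and `|F(q) + Σ_{i≤n} ℓ_i^G(F)(q)| ≤ 2·qq·b n` (induction on `n`, each step = part I).

At `n = nScales β` this is the one-volume frame of `CtOneVolumeMsV11` up to the half-tolerance reading (part H′ with `T = tol/2`) and the
choice of the volume — part J₂.  Proofs only; nothing is asserted about the Hubbard model.
-/

noncomputable section

namespace Summit.HubbardSuperconductivity.HubbardSuperconductivity.Theorems.KLRegimeSplit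

set_option linter.dupNamespace false -- summit = problem name (single-conjunct summit), D-0017

open Real Finset
open Literature.MathematicalPhysics.QuantumLattice Literature.Probability.LatticeModels
open Summit.HubbardSuperconductivity.HubbardSuperconductivity.Theorems.KLProgrammeLegKernels

/-- **The zero frame is admissible** whenever the order-`≤ 2` allowance sums are small on the covariance window
(`frameOK_of_pieces` with all pieces zero). -/
theorem frameOK_zeroFrame {R : RenConsts} (hR : ∀ j, 0 ≤ R.Gfr j) {U μ : ℝ} {N : ℕ} (hμ : μ ∈ Set.Icc (-1.05 : ℝ) (-0.15))
    (h0 : ∑ n ∈ range (N + 1), R.Gfr 0 * uPow 0 U * (4 : ℝ) ^ (((0 : ℤ) - 2) * n) ≤ 3 / 80)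
    (h1 : ∑ n ∈ range (N + 1), R.Gfr 1 * uPow 1 U * (4 : ℝ) ^ (((1 : ℤ) - 2) * n) ≤ 1 / 2000)
    (h2 : ∑ n ∈ range (N + 1), ∑ j ∈ range 3, R.Gfr j * uPow j U * (4 : ℝ) ^ (((j : ℤ) - 2) * n) ≤ 1 / 100) :
    FrameOK R U N μ (0 : TrigPolyC4v) := by
  refine frameOK_of_pieces hR hμ (Kp := fun _ => (0 : TrigPolyC4v)) (fun p => ?_) (fun n _ j _ q => ?_) h0 h1 h2
  · simp [eval_fsub, TrigPolyC4v.eval_zero]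
  · have hz : evalM (0 : TrigPolyC4v) = fun _ : Momentum => (0 : ℝ) := by
      funext q'; simp [evalM_apply, TrigPolyC4v.eval_zero]
    rw [hz, iteratedFDeriv_fun_zero]
    simp only [Pi.zero_apply, norm_zero]
    exact mul_nonneg (mul_nonneg (hR j) (uPow_nonneg j U)) (zpow_nonneg (by norm_num) _)

section Model

variable {L M : ℕ} [NeZero L] [NeZero M]

variable {G : GeoConsts} {P : SplitConsts} {Q : EngConsts} (hG : G.WF) (hQ : Q.WF) {β U μ : ℝ} (hμ : μ ∈ Set.Icc (-1.05 : ℝ) (-0.15))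
  {Lh : ℕ} {Mh : ℕ → ℕ} (hyp : CtHypMsV11 G P Q β U μ Lh Mh) (hLh : Lh ≤ L) (hMh : Mh L ≤ M)
  (ha : ∀ j ≤ 4, 2 * (G.S j + Q.S' j * |U|) ≤ (ctRenMs G).Gfr j)
  (hb : ∀ n : ℕ, ∑ i ∈ range (n + 1), msBar G Q U i ≤ 1 / 2)
  (h0 : ∑ m ∈ range (nScales β + 1), (ctRenMs G).Gfr 0 * uPow 0 U * (4 : ℝ) ^ (((0 : ℤ) - 2) * m) ≤ 3 / 80)
  (h1 : ∑ m ∈ range (nScales β + 1), (ctRenMs G).Gfr 1 * uPow 1 U * (4 : ℝ) ^ (((1 : ℤ) - 2) * m) ≤ 1 / 2000)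
  (h2 : ∑ m ∈ range (nScales β + 1), ∑ j ∈ range 3,
      (ctRenMs G).Gfr j * uPow j U * (4 : ℝ) ^ (((j : ℤ) - 2) * m) ≤ 1 / 100)
  {qq : ℝ} (hqq0 : 0 ≤ qq) (hqq : ∀ n : ℕ, ∑ i ∈ range (n + 1), lipBar G Q U i ≤ qq) (hqq32 : 32 * qq ≤ 1)
  {w : ℝ}
  (gate : ∀ K : TrigPolyC4v, FrameOK (ctRenMs G) U (nScales β) μ K → ∀ n ≤ nScales β, ∀ B : ℕ → ℝ,
    (∀ j ≤ n, (∀ i < j, RenormalisedAtF L M β U μ K (ctRenMs G) i) →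
      ∀ q : Fin 2 → ℝ, |K.eval q + ∑ i ∈ range (j + 1), (klTwoLegPieceG L M β U μ K i).eval q| ≤ B j) →
    (∀ j ≤ n, B j + w ≤ ctCr G * |U| * klScale klE0 j ^ 2 / klE0) →
    ∀ j ≤ n, RenormalisedAtF L M β U μ K (ctRenMs G) j)
  (htolAll : ∀ n ≤ nScales β, ∀ j ≤ n,
    2 * qq * twoLegBar G Q U 0 n + ∑ i ∈ Ico (j + 1) (n + 1), twoLegBar G Q U 0 i + w ≤ ctCr G * |U| * klScale klE0 j ^ 2 / klE0)

include hG hQ hμ hyp hLh hMh ha hb h0 h1 h2 hqq0 hqq hqq32 gate htolAll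

/-- **THE LEVEL FRAMES EXIST.**  For every `n ≤ nScales β` there is an admissible frame renormalised at every scale `≤ n` whose partial sums
obey the level-`n` bounds (the frame `K^{(n)}` of the recursion). -/
theorem exists_levelFrame : ∀ n ≤ nScales β, ∃ F : TrigPolyC4v,
    FrameOK (ctRenMs G) U (nScales β) μ F ∧
    (∀ j ≤ n, RenormalisedAtF L M β U μ F (ctRenMs G) j) ∧
    (∀ j ≤ n, ∀ q : Fin 2 → ℝ, |F.eval q + ∑ i ∈ range (j + 1), (klTwoLegPieceG L M β U μ F i).eval q| ≤
      2 * qq * twoLegBar G Q U 0 n + ∑ i ∈ Ico (j + 1) (n + 1), twoLegBar G Q U 0 i) ∧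
    (∀ q : Fin 2 → ℝ, |F.eval q + ∑ i ∈ range (n + 1), (klTwoLegPieceG L M β U μ F i).eval q| ≤ 2 * qq * twoLegBar G Q U 0 n) := by
  have hR : ∀ j, 0 ≤ (ctRenMs G).Gfr j := ctRenMs_Gfr_nonneg hG
  have hS0 : 0 ≤ G.S 0 + Q.S' 0 * |U| := by
    have := hG.2.2.2.2.2.2.2.2.2.2.2.2.2.2.2.2.2.1 0; have := hQ.2.2.2.2.1 0; positivity
  have hb0 : ∀ i, 0 ≤ twoLegBar G Q U 0 i := fun i => by rw [twoLegBar_zero_eq]; positivity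
  intro n
  induction n with
  | zero =>
    intro _
    -- level 0 from the zero frame
    have hZ : FrameOK (ctRenMs G) U (nScales β) μ (0 : TrigPolyC4v) := frameOK_zeroFrame hR hμ h0 h1 h2
    have hSF : ∀ q : Fin 2 → ℝ, |(0 : TrigPolyC4v).eval q + ∑ i ∈ range 0, (klTwoLegPieceG L M β U μ 0 i).eval q| ≤
        2 * qq * (16 * twoLegBar G Q U 0 0) := fun q => by
      simp only [TrigPolyC4v.eval_zero, sum_range_zero, add_zero, abs_zero]
      have := hb0 0; positivity
    obtain ⟨hF', hren, -, hall, htop⟩ := levelStep hG hQ hμ hyp hLh hMh ha hb h0 h1 h2 hqq0 hqq hqq32 gate (Nat.zero_le _) hZ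
      (fun j hj => absurd hj (Nat.not_lt_zero j)) hSF (htolAll 0 (Nat.zero_le _))
    exact ⟨_, hF', hren, hall, htop⟩
  | succ n ih =>
    intro hn1
    obtain ⟨F, hF, hren, -, htop⟩ := ih (Nat.le_of_succ_le hn1)
    have hSF : ∀ q : Fin 2 → ℝ, |F.eval q + ∑ i ∈ range (n + 1), (klTwoLegPieceG L M β U μ F i).eval q| ≤
        2 * qq * (16 * twoLegBar G Q U 0 (n + 1)) := fun q => by
      rw [← twoLegBar_zero_succ]; exact htop q
    obtain ⟨hF', hren', -, hall', htop'⟩ := levelStep hG hQ hμ hyp hLh hMh ha hb h0 h1 h2 hqq0 hqq hqq32 gate hn1 hF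
      (fun j hj => hren j (Nat.lt_succ_iff.mp hj)) hSF (htolAll (n + 1) hn1)
    exact ⟨_, hF', hren', hall', htop'⟩

/-- **THE TOP LEVEL**: an admissible frame renormalised at EVERY scale `≤ nScales β` with
`|F(q) + Σ_{i≤j} ℓ_i^G(F)(q)| ≤ 2·qq·b N + Σ_{j<i≤N} b i` for all `j ≤ N = nScales β` (the input of the half-tolerance reading). -/
theorem exists_topFrame : ∃ F : TrigPolyC4v,
    FrameOK (ctRenMs G) U (nScales β) μ F ∧
    (∀ j ≤ nScales β, RenormalisedAtF L M β U μ F (ctRenMs G) j) ∧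
    (∀ j ≤ nScales β, ∀ q : Fin 2 → ℝ, |F.eval q + ∑ i ∈ range (j + 1), (klTwoLegPieceG L M β U μ F i).eval q| ≤
      2 * qq * twoLegBar G Q U 0 (nScales β) + ∑ i ∈ Ico (j + 1) (nScales β + 1), twoLegBar G Q U 0 i) := by
  obtain ⟨F, hF, hren, hall, -⟩ := exists_levelFrame hG hQ hμ hyp hLh hMh ha hb h0 h1 h2 hqq0 hqq hqq32 gate htolAll
    (nScales β) le_rfl
  exact ⟨F, hF, hren, hall⟩

end Model

end Summit.HubbardSuperconductivity.HubbardSuperconductivity.Theorems.KLRegimeSplit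

end
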